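import Literature.MathematicalPhysics.QuantumLattice.HubbardRingPerronFrobeniusProofs
import Literature.MathematicalPhysics.QuantumLattice.FinDimSpectrumProofs
import Literature.MathematicalPhysics.QuantumLattice.HubbardModel
import HarnessLib

/-!
# Crux `CwThesis` (stmt-HubbardSuperconductivity-10438, route `ChiralWindow`), line
`SketchIdeator3` (penalty line, thermal form) — stub `stub_blockGroundEnergy`

**Block ground energy = sector energy** (the bookkeeping identity of the line, converting the
ground energies of compressed block Hamiltonians into the sector energies
`Matrix.minEnergyOn _ (szSector (2n) 0)` that `TorusCooperLog.PenaltyResponseLRO` speaks about).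

* `groundEnergy_toBlock_eq_minEnergyOn` — generic linear algebra over an abstract finite index type
  `ι` (instances `[Fintype ι] [DecidableEq ι] [DecidablePred p]` are PARAMETERS, so that the
  specialisation below unifies with the structural instances of the Fock space of the torus): for a
  Hermitian matrix `A`, a decidable predicate `p` with `{i // p i}` nonempty and a submodule `K` whose
  carrier is the coordinate subspace `{v | v i = 0 unless p i}`, the ground energy of the compression
  `A.toBlock p p` equals `A.minEnergyOn K`. Proof: extension by zero / restriction identify the unit
  vectors of `K` with the unit block vectors and intertwine the Rayleigh quotients
  (`⟨ext φ, A ext φ⟩ = ⟨φ, A|_p φ⟩` — no invariance of `K` under `A` is needed, in contrast to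
  `Literature.MathematicalPhysics.QuantumLattice.sector_groundState`), so the two Rayleigh sets
  coincide; on the block, the Rayleigh infimum over the whole space is the ground energy
  (`Matrix.minEnergyOn_top_holds`, block Hermitian by `Matrix.IsHermitian.submatrix`).
* `stub_blockGroundEnergy` — the registered stub: on the fermionic torus of side `L`, for `n ≤ L²`,
  the ground energy of the compression of a Hermitian `A` to Lieb's `(n,n)` occupation sector
  `p s := #upPart s = n ∧ #downPart s = n` is `A.minEnergyOn (szSector (2n) 0)`; the sector is the
  coordinate subspace of `p` (`mem_szSector_two_mul_zero_iff`) and is nonempty (`pairSet α α` for an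
  `n`-subset `α` of the `L²` sites).

All statements are finite-dimensional linear algebra (Tasaki, *Physics and Mathematics of Quantum
Many-Body Systems* (2020), §2.1–2.2; Lieb, PRL 62 (1989) 1201, "I work in the `S^z = 0` subspace").
No definition is introduced. [folklore]
-/

noncomputable section

namespace Summit.HubbardSuperconductivity.HubbardSuperconductivity.Theorems.CwThesis

-- `dupNamespace`: the summit and the problem are both named `HubbardSuperconductivity` (layout D-0022)
set_option linter.dupNamespace false
-- the `(n,n)`-sector index type `{s : Finset (Orb Λ) // …}` needs a larger instance budget for
-- `DecidableEq` (structural instance through `Lex (Fin 2 → Fin L)`; tree precedent: GaugedHubbardTorus)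
set_option synthInstance.maxSize 512

open Matrix Literature.MathematicalPhysics.QuantumLattice
open scoped ComplexOrder

/-- **Ground energy of a compression = sector energy of the coordinate subspace.** For a Hermitian
matrix `A` on a finite index type `ι`, a decidable predicate `p` with `{i // p i}` nonempty, and a
submodule `K ≤ (ι → ℂ)` whose carrier is the coordinate subspace `{v | ∀ i, ¬ p i → v i = 0}`, the
ground energy of the block `A.toBlock p p` is `A.minEnergyOn K`: extension by zero and restriction
put the unit vectors of `K` in bijection with the unit block vectors and intertwine the Rayleigh
quotients, and on the (nonempty) block the Rayleigh infimum is the ground energy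
(`Matrix.minEnergyOn_top_holds`). Tasaki (2020) §2.1–2.2. [folklore] -/
theorem groundEnergy_toBlock_eq_minEnergyOn {ι : Type*} [Fintype ι] [DecidableEq ι]
    (A : Matrix ι ι ℂ) (hA : A.IsHermitian) (p : ι → Prop) [DecidablePred p]
    [Nonempty {i // p i}] (K : Submodule ℂ (ι → ℂ)) (hK : ∀ v, v ∈ K ↔ ∀ i, ¬ p i → v i = 0) :
    (A.toBlock p p).groundEnergy = A.minEnergyOn K := by
  set B : Matrix {i // p i} {i // p i} ℂ := A.toBlock p p with hB
  have hBh : B.IsHermitian := hA.submatrix _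
  -- extension by zero and restriction
  set ext : ({i // p i} → ℂ) → (ι → ℂ) := fun φ i => if h : p i then φ ⟨i, h⟩ else 0 with hext
  set res : (ι → ℂ) → ({i // p i} → ℂ) := fun v a => v a.1 with hres
  have hext_apply : ∀ φ (a : {i // p i}), ext φ a.1 = φ a := fun φ a => by simp [hext, a.2]
  have hext_not : ∀ φ i, ¬ p i → ext φ i = 0 := fun φ i hi => by simp [hext, hi]
  have hres_ext : ∀ φ, res (ext φ) = φ := fun φ => funext fun a => hext_apply φ a
  have hext_res : ∀ v ∈ K, ext (res v) = v := by
    intro v hv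
    funext i
    by_cases hi : p i
    · exact hext_apply (res v) ⟨i, hi⟩
    · rw [hext_not _ i hi, ((hK v).1 hv) i hi]
  have hext_mem : ∀ φ, ext φ ∈ K := fun φ => (hK _).2 fun i hi => hext_not φ i hi
  -- the block acts as `A` on extensions, followed by restriction (no invariance needed)
  have hres_A : ∀ φ, res (A *ᵥ ext φ) = B *ᵥ φ := by
    intro φ
    funext a
    show (A *ᵥ ext φ) a.1 = (B *ᵥ φ) a
    rw [mulVec, dotProduct, mulVec, dotProduct, sum_eq_sum_subtype_of_support p]
    · refine Finset.sum_congr rfl fun b _ => ?_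
      rw [hext_apply]
      rfl
    · intro j hj
      rw [hext_not φ j hj, mul_zero]
  have hdot : ∀ φ (w : ι → ℂ), star (ext φ) ⬝ᵥ w = star φ ⬝ᵥ res w := by
    intro φ w
    rw [dotProduct, dotProduct, sum_eq_sum_subtype_of_support p]
    · refine Finset.sum_congr rfl fun a _ => ?_
      rw [Pi.star_apply, Pi.star_apply, hext_apply]
    · intro j hj
      rw [Pi.star_apply, hext_not φ j hj, star_zero, zero_mul]
  -- the Rayleigh sets coincide
  have hset : {E : ℝ | ∃ ψ ∈ K, star ψ ⬝ᵥ ψ = 1 ∧ E = (star ψ ⬝ᵥ A *ᵥ ψ).re} =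
      {E : ℝ | ∃ φ ∈ (⊤ : Submodule ℂ ({i // p i} → ℂ)), star φ ⬝ᵥ φ = 1 ∧
        E = (star φ ⬝ᵥ B *ᵥ φ).re} := by
    ext E
    constructor
    · rintro ⟨ψ, hψK, hψ1, rfl⟩
      refine ⟨res ψ, Submodule.mem_top, ?_, ?_⟩
      · rw [← hψ1, ← hext_res ψ hψK, hdot, hres_ext]
      · conv_lhs => rw [← hext_res ψ hψK, hdot, hres_A]
    · rintro ⟨φ, -, hφ1, rfl⟩
      refine ⟨ext φ, hext_mem φ, ?_, ?_⟩
      · rw [hdot, hres_ext, hφ1]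
      · rw [hdot, hres_A]
  rw [Matrix.minEnergyOn, hset, ← Matrix.minEnergyOn_top_holds hBh]
  rfl

/-- **Block ground energy = sector energy** (stub `stub_blockGroundEnergy` of line `SketchIdeator3`
of crux `CwThesis`). For a Hermitian matrix `A` on the fermionic Fock space of the torus of side `L`
and `n ≤ L²` (so that Lieb's `(n,n)` sector is nonempty: `pairSet α α` for an `n`-subset `α` of the
`L²` sites), the ground energy of the compression `A.toBlock p p` to the occupation sets with `n` up-
and `n` down-spins equals `A.minEnergyOn (szSector (2n) 0)`: the joint sector `(N, S^z) = (2n, 0)`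
is the coordinate subspace of those occupation sets (`mem_szSector_two_mul_zero_iff`), and
`groundEnergy_toBlock_eq_minEnergyOn` applies. Lieb, PRL 62 (1989) 1201; Tasaki (2020) §2.1–2.2.
[folklore] -/
theorem stub_blockGroundEnergy (L : ℕ)
    (A : Matrix (Finset (Orb (FermionTorus 2 L))) (Finset (Orb (FermionTorus 2 L))) ℂ)
    (hA : A.IsHermitian) {n : ℕ} (hn : n ≤ L ^ 2) :
    (A.toBlock (fun s => (upPart s).card = n ∧ (downPart s).card = n)
        (fun s => (upPart s).card = n ∧ (downPart s).card = n)).groundEnergy =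
      A.minEnergyOn (szSector (2 * n) 0) := by
  -- the `(n,n)` sector is nonempty: `|FermionTorus 2 L| = L²`, take an `n`-subset `α` and `pairSet α α`
  have hcard : Fintype.card (FermionTorus 2 L) = L ^ 2 := by
    change Fintype.card (Fin 2 → Fin L) = L ^ 2
    rw [Fintype.card_fun, Fintype.card_fin, Fintype.card_fin]
  obtain ⟨α, -, hα⟩ := Finset.exists_subset_card_eq (s := (Finset.univ : Finset (FermionTorus 2 L)))
    (n := n) (by rw [Finset.card_univ, hcard]; exact hn)
  haveI : Nonempty
      {s : Finset (Orb (FermionTorus 2 L)) // (upPart s).card = n ∧ (downPart s).card = n} :=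
    ⟨⟨pairSet α α, by rw [upPart_pairSet, hα], by rw [downPart_pairSet, hα]⟩⟩
  exact groundEnergy_toBlock_eq_minEnergyOn A hA _ (szSector (2 * n) 0)
    (fun v => mem_szSector_two_mul_zero_iff n v)

end Summit.HubbardSuperconductivity.HubbardSuperconductivity.Theorems.CwThesis

end
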